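/-
Copyright: the b2b-balaban T⁴-continuum CRUX team, row NE7b OWNER lineage `t4-ne7b-p1` (gen 138). Project licence.
-/
import Mathlib.Analysis.InnerProductSpace.PiL2
import Mathlib.Analysis.Calculus.MeanValue
import Mathlib.Analysis.SpecialFunctions.Pow.Real

/-!
# POWER COUNTING WITH LOCALITY — THE LETTER FORMAT IN WHICH THE RESCALING IS EXACT: letters of a potential measured on SUP-NORM balls
# (`|φ_x| ≤ R` at every site, test vectors `|h_x| ≤ 1` at every site) transport through the canonical rescaling `A = t • J_β` of (429)
# by EXACTLY `|t|^k` at order `k` with the small-field radius ENLARGED to `R∕|t|` — because the block-constant injection `J_β` is a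
# sup-norm contraction (`|(J_β v)_x| = |v_{βx}|`), where the Euclidean operator norm of (428) pays `‖J_β‖ = √n` per slot.  With the
# letters EXTENSIVE in the number of sites (`K = N·κ`, `N = n·N′`), the per-site letter of order `k` moves by `n·|t|^k =
# L^{d − k(d−2)∕2}`: at `d = 4` (`t = L⁻¹`, `n = L⁴`) the table `L⁴, L³, L², L, 1, L⁻¹, L⁻²` for `k = 0,…,6` — orders `≤ 3` RELEVANT,
# `4` MARGINAL, `≥ 5` IRRELEVANT; and a letter whose value at `φ = 0` has been EXTRACTED is DERIVED from the next one (`|U″(φ)[h,k] −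
# U″(0)[h,k]| ≤ R·K₃`, mean value along the segment) — the YES-format located by (430)'s NO, its bookkeeping half typed (SCOPING (d9)→(d10);
# row NE7b, node U5c; Mathlib only; [folklore])

Cell `pub-balaban`, sub-cell `t4`, spine estimate NE7b (`T4WeightBudget.RelWeightBound`; the cell's OWN estimate — NOT PRINTED in
[Bałaban 1983–89], NOT PROVED).  Crux-route work under `Spine/NE7b/` by the row OWNER (`t4-ne7b-p1` gen 138, file (431)) under FREEZE
(0)'s crux-prover clause; NOTHING of Bałaban's is named as a Lean object, valued or asserted; no `T4Continuum/Support` leaf typed; no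
`def`, no notation; zero `sorry`.  Imports: Mathlib only (fast lane); (428) (its `hess_apply`∕`third_apply` identify the values
`U″(Av)(Ah)(Ak)`, `U‴(Av)(Ah)(Ak)(Al)` below with the transported derivative maps) and (429) (`A = t • J_β`, written out identically) are
met BY SHAPE.

WHY ((d9)(2) verdict, file (430)).  The nine-sup-letter class cannot be iterated through a coarse-graining: its quadratic letters are
mass-type relevant (`× L²`), and the operator-norm transport of (428) charges `‖A‖^k = L^k` at order `k` (at `d = 4`), against power
counting's `L^{4−k}`, because `‖J_β‖ = √n` on `ℓ²` while a local potential only ever sees ONE coarse value per fine site.  In the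
sup-norm format the injection costs NOTHING (`J_β` maps the unit sup-ball into the unit sup-ball), the homothety costs `|t|` per test
slot, and the small-field radius is divided by `|t|` (enlarged): the letter of order `k` of `U ∘ A` on the ball `R∕|t|` is `|t|^k` times
that of `U` on the ball `R` — for EVERY `k`, with no `n`.  The block size enters only through EXTENSIVITY (a potential local in `N`
fine sites has letters `N·κ`; the same region has `N∕n` coarse sites), giving the per-site factor `n|t|^k` = power counting.  What
makes a flow possible is then visible: the letters that accumulate are the MARGINAL one (`k = 4` at `d = 4`, the quartic coupling — the
β-function's object) and the IRRELEVANT ones (`k ≥ 5`, contracting by `L^{4−k} ≤ L⁻¹`), provided the relevant orders `k ≤ 3` are not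
carried as letters but EXTRACTED at every step (Taylor data at `φ = 0`: vacuum energy, [odd orders by symmetry], mass∕wave-function —
finitely many couplings per site, renormalised) — after extraction the order-`k` letter is DERIVED from the order-`k+1` one and the
radius (§3: `R·K₃`), never iterated.  THIS FILE types the transport, the derivation-by-extraction at order 2, the extensivity
arithmetic and the canonical table; the fluctuation step in this format (sup-norm letters of `w⁺` = decay of the dressed covariance
inside and across blocks, (β3′)) and the extraction to order 4 with large-field suppression ((β4)) are NOT typed — they are the road.

WHAT IS PROVED ([folklore]; `β : ι → ι′`, `A := t • ((EuclideanSpace.equiv ι ℝ).symm ∘L ContinuousLinearMap.pi (fun x ↦ EuclideanSpace.proj (β x)))`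
written out; sup-balls as `∀ x, |φ x| ≤ R`):
* §1 SUP-NORM TRANSPORT OF FIELDS: `abs_inj_apply_le` (`|v_y| ≤ r ∀y ⟹ |(J_β v)_x| ≤ r ∀x`), `abs_rescaled_apply_le` (`⟹ |(A v)_x| ≤ |t|·r`),
  `rescaled_eq_smul_inj` (`A v = t • J_β v`).
* §2 LETTER TRANSPORT, ORDERS 0–3: `letter0_transport` (`|U(Av)| ≤ K₀` on the ball `R′` whenever `|t|R′ ≤ R`), `letter1_transport`
  (`|U′(Av)(Ah)| ≤ |t|·K₁`), `letter2_transport` (`|U″(Av)(Ah)(Ak)| ≤ t²·K₂`), `letter3_transport` (`|U‴(Av)(Ah)(Ak)(Al)| ≤ |t|³·K₃`) — radius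
  `R∕|t|`, unit sup-ball test vectors, NO factor `n`.
* §3 DERIVATION BY EXTRACTION: `hasDerivAt_hess_along_segment` (`s ↦ U″(s•φ)[h,k]` has derivative `U‴(s•φ)[φ,h,k]`), **`letter2_derived`**
  (`|U″(φ)[h,k] − U″(0)[h,k]| ≤ R·K₃` for `|φ|_∞ ≤ R`, `R > 0`: after extracting `U″(0)` the quadratic letter is `R·K₃`, not an independent datum).
* §4 EXTENSIVITY AND THE CANONICAL TABLE (real arithmetic): `per_site_letter` (`K = Nκ`, `N = nN′ ⟹ |t|^k K ∕ N′ = (n|t|^k)·κ`),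
  `canonical_power` (`L^d·(L^{−(d−2)∕2})^k = L^{d − k(d−2)∕2}`, real powers), `canonical_table_dim4` (`L⁴·(L⁻¹)^k = L^{4−k}`, `k = 0,…,6` as
  `L⁴, L³, L², L, 1, L⁻¹, L⁻²`), `relevant_marginal_irrelevant_dim4` (`1 < L ⟹` the factors for `k ≤ 3` exceed `1`, `k = 4` equals `1`,
  `k = 5, 6` are `< 1`).
* §5 toy (kernel): `L = 2`: the order-5 factor is `1∕2`.

HONEST (what this is NOT).  Bookkeeping only: the fluctuation half (427) is typed in the Euclidean format, NOT in this one; converting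
costs `√n` per slot (`‖h‖₂ ≤ √n‖h‖_∞`) and is NOT iterable — the sup-norm letters of `w⁺` must come from decay of the dressed
covariance (cluster expansion, (β3′)), not from (427).  Taylor extraction to order 4, the symmetry killing odd orders, the flow of the
extracted couplings (β-function; the β-flow team's B12 Thm 2) and large-field suppression beyond the radius are NOT typed ((β4)).
Scalar skeleton ((A3), NC-NE7b-α UNRULED); nothing of Bałaban's asserted.  BY-NAME EFFECT ON THE WALL: NONE.  NE7b NOT PRINTED ∕ NOT
PROVED; spine PROVED 0∕9; rung (B)+1 — the programme's measures remain FINITE-torus statements; NOT the mass gap, NOT Clay.  HONEST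
DEPENDENCY: continuum YM on T⁴ ⇐ BetaPertH ∧ nine spine estimates (0∕9 proved); BetaPertH ⇐ (D1) ∧ (D4) ∧ CAP+tail; G-an2-4 gates asym,
D1 and NE2∕3∕4.
-/

set_option autoImplicit false
set_option maxSynthPendingDepth 3

noncomputable section

namespace Summit.QuantumFields.BalabanUV.T4Continuum.NE7b.SupPowerCountingLetters

open Set Real

variable {ι ι' : Type} [Fintype ι] [Fintype ι']

variable {U : EuclideanSpace ℝ ι → ℝ} {U' : EuclideanSpace ℝ ι → EuclideanSpace ℝ ι →L[ℝ] ℝ}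
  {U'' : EuclideanSpace ℝ ι → EuclideanSpace ℝ ι →L[ℝ] EuclideanSpace ℝ ι →L[ℝ] ℝ}
  {U₃ : EuclideanSpace ℝ ι → EuclideanSpace ℝ ι →L[ℝ] EuclideanSpace ℝ ι →L[ℝ] EuclideanSpace ℝ ι →L[ℝ] ℝ}
  {K₀ K₁ K₂ K₃ R R' r t : ℝ}

/-! ## §1. Sup-norm transport of fields through `A = t • J_β` -/

omit [Fintype ι] [Fintype ι'] in
/-- **`J_β` is a sup-norm contraction**: `|v_y| ≤ r` at every coarse site gives `|(J_β v)_x| ≤ r` at every fine site. [folklore] -/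
theorem abs_inj_apply_le (β : ι → ι') {v : EuclideanSpace ℝ ι'} (hv : ∀ y, |v y| ≤ r) (x : ι) :
    |((((EuclideanSpace.equiv ι ℝ).symm : (ι → ℝ) →L[ℝ] EuclideanSpace ℝ ι).comp
        (ContinuousLinearMap.pi fun x : ι => (EuclideanSpace.proj (β x) : EuclideanSpace ℝ ι' →L[ℝ] ℝ))) v) x| ≤ r :=
  hv (β x)

omit [Fintype ι'] in
/-- **The rescaled field on the sup-ball**: `|v_y| ≤ r` at every coarse site gives `|(A v)_x| ≤ |t|·r` at every fine site. [folklore] -/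
theorem abs_rescaled_apply_le (β : ι → ι') (t : ℝ) {v : EuclideanSpace ℝ ι'} (hv : ∀ y, |v y| ≤ r) (x : ι) :
    |((t • (((EuclideanSpace.equiv ι ℝ).symm : (ι → ℝ) →L[ℝ] EuclideanSpace ℝ ι).comp
        (ContinuousLinearMap.pi fun x : ι => (EuclideanSpace.proj (β x) : EuclideanSpace ℝ ι' →L[ℝ] ℝ)))) v) x| ≤ |t| * r := by
  have h : ((t • (((EuclideanSpace.equiv ι ℝ).symm : (ι → ℝ) →L[ℝ] EuclideanSpace ℝ ι).comp
        (ContinuousLinearMap.pi fun x : ι => (EuclideanSpace.proj (β x) : EuclideanSpace ℝ ι' →L[ℝ] ℝ)))) v) x = t * v (β x) := rfl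
  rw [h, abs_mul]
  exact mul_le_mul_of_nonneg_left (hv (β x)) (abs_nonneg t)

omit [Fintype ι'] in
/-- `A v = t • (J_β v)`. [folklore] -/
theorem rescaled_eq_smul_inj (β : ι → ι') (t : ℝ) (v : EuclideanSpace ℝ ι') :
    (t • (((EuclideanSpace.equiv ι ℝ).symm : (ι → ℝ) →L[ℝ] EuclideanSpace ℝ ι).comp
        (ContinuousLinearMap.pi fun x : ι => (EuclideanSpace.proj (β x) : EuclideanSpace ℝ ι' →L[ℝ] ℝ)))) v =
      t • ((((EuclideanSpace.equiv ι ℝ).symm : (ι → ℝ) →L[ℝ] EuclideanSpace ℝ ι).comp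
        (ContinuousLinearMap.pi fun x : ι => (EuclideanSpace.proj (β x) : EuclideanSpace ℝ ι' →L[ℝ] ℝ))) v) :=
  rfl

/-! ## §2. Letter transport at orders 0–3: `|t|^k`, radius `R∕|t|`, no factor `n` -/

omit [Fintype ι'] in
/-- **ORDER 0**: a bound `|U φ| ≤ K₀` on the sup-ball of radius `R` gives `|U(Av)| ≤ K₀` on the coarse sup-ball of radius `R′` whenever
`|t|·R′ ≤ R` (the radius is divided by `|t|`, the letter unchanged). [folklore] -/
theorem letter0_transport (β : ι → ι') (hU : ∀ φ : EuclideanSpace ℝ ι, (∀ x, |φ x| ≤ R) → |U φ| ≤ K₀) (hR : |t| * R' ≤ R) :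
    ∀ v : EuclideanSpace ℝ ι', (∀ y, |v y| ≤ R') →
      |U ((t • (((EuclideanSpace.equiv ι ℝ).symm : (ι → ℝ) →L[ℝ] EuclideanSpace ℝ ι).comp
        (ContinuousLinearMap.pi fun x : ι => (EuclideanSpace.proj (β x) : EuclideanSpace ℝ ι' →L[ℝ] ℝ)))) v)| ≤ K₀ :=
  fun _ hv => hU _ fun x => (abs_rescaled_apply_le β t hv x).trans hR

omit [Fintype ι'] in
/-- **ORDER 1**: `|U′(φ)[h]| ≤ K₁` for `|φ|_∞ ≤ R`, `|h|_∞ ≤ 1` gives `|U′(Av)[Ah]| ≤ |t|·K₁` for `|v|_∞ ≤ R′` (`|t|R′ ≤ R`), `|h|_∞ ≤ 1`. [folklore] -/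
theorem letter1_transport (β : ι → ι')
    (hU' : ∀ φ h : EuclideanSpace ℝ ι, (∀ x, |φ x| ≤ R) → (∀ x, |h x| ≤ 1) → |U' φ h| ≤ K₁) (hR : |t| * R' ≤ R) :
    ∀ v h : EuclideanSpace ℝ ι', (∀ y, |v y| ≤ R') → (∀ y, |h y| ≤ 1) →
      |U' ((t • (((EuclideanSpace.equiv ι ℝ).symm : (ι → ℝ) →L[ℝ] EuclideanSpace ℝ ι).comp
          (ContinuousLinearMap.pi fun x : ι => (EuclideanSpace.proj (β x) : EuclideanSpace ℝ ι' →L[ℝ] ℝ)))) v)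
        ((t • (((EuclideanSpace.equiv ι ℝ).symm : (ι → ℝ) →L[ℝ] EuclideanSpace ℝ ι).comp
          (ContinuousLinearMap.pi fun x : ι => (EuclideanSpace.proj (β x) : EuclideanSpace ℝ ι' →L[ℝ] ℝ)))) h)| ≤ |t| * K₁ := by
  intro v h hv hh
  rw [rescaled_eq_smul_inj β t h, map_smul, smul_eq_mul, abs_mul]
  exact mul_le_mul_of_nonneg_left (hU' _ _ (fun x => (abs_rescaled_apply_le β t hv x).trans hR) fun x => abs_inj_apply_le β hh x)
    (abs_nonneg t)

omit [Fintype ι'] in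
/-- **ORDER 2**: `|U″(φ)[h,k]| ≤ K₂` on the sup-balls gives `|U″(Av)[Ah,Ak]| ≤ t²·K₂` on the coarse sup-balls (radius `R∕|t|`). [folklore] -/
theorem letter2_transport (β : ι → ι')
    (hU'' : ∀ φ h k : EuclideanSpace ℝ ι, (∀ x, |φ x| ≤ R) → (∀ x, |h x| ≤ 1) → (∀ x, |k x| ≤ 1) → |U'' φ h k| ≤ K₂) (hR : |t| * R' ≤ R) :
    ∀ v h k : EuclideanSpace ℝ ι', (∀ y, |v y| ≤ R') → (∀ y, |h y| ≤ 1) → (∀ y, |k y| ≤ 1) →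
      |U'' ((t • (((EuclideanSpace.equiv ι ℝ).symm : (ι → ℝ) →L[ℝ] EuclideanSpace ℝ ι).comp
          (ContinuousLinearMap.pi fun x : ι => (EuclideanSpace.proj (β x) : EuclideanSpace ℝ ι' →L[ℝ] ℝ)))) v)
        ((t • (((EuclideanSpace.equiv ι ℝ).symm : (ι → ℝ) →L[ℝ] EuclideanSpace ℝ ι).comp
          (ContinuousLinearMap.pi fun x : ι => (EuclideanSpace.proj (β x) : EuclideanSpace ℝ ι' →L[ℝ] ℝ)))) h)
        ((t • (((EuclideanSpace.equiv ι ℝ).symm : (ι → ℝ) →L[ℝ] EuclideanSpace ℝ ι).comp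
          (ContinuousLinearMap.pi fun x : ι => (EuclideanSpace.proj (β x) : EuclideanSpace ℝ ι' →L[ℝ] ℝ)))) k)| ≤ t ^ 2 * K₂ := by
  intro v h k hv hh hk
  rw [rescaled_eq_smul_inj β t h, rescaled_eq_smul_inj β t k, map_smul, map_smul, smul_eq_mul]
  rw [show ∀ (f : EuclideanSpace ℝ ι →L[ℝ] ℝ) (z : EuclideanSpace ℝ ι), (t • f) z = t * f z from fun f z => rfl, abs_mul, abs_mul, ← mul_assoc,
    show |t| * |t| = t ^ 2 by rw [← sq, sq_abs]]
  exact mul_le_mul_of_nonneg_left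
    (hU'' _ _ _ (fun x => (abs_rescaled_apply_le β t hv x).trans hR) (fun x => abs_inj_apply_le β hh x) fun x => abs_inj_apply_le β hk x) (sq_nonneg t)

omit [Fintype ι'] in
/-- **ORDER 3**: `|U‴(φ)[h,k,l]| ≤ K₃` on the sup-balls gives `|U‴(Av)[Ah,Ak,Al]| ≤ |t|³·K₃` on the coarse sup-balls (radius `R∕|t|`). [folklore] -/
theorem letter3_transport (β : ι → ι')
    (hU₃ : ∀ φ h k l : EuclideanSpace ℝ ι, (∀ x, |φ x| ≤ R) → (∀ x, |h x| ≤ 1) → (∀ x, |k x| ≤ 1) → (∀ x, |l x| ≤ 1) → |U₃ φ h k l| ≤ K₃)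
    (hR : |t| * R' ≤ R) :
    ∀ v h k l : EuclideanSpace ℝ ι', (∀ y, |v y| ≤ R') → (∀ y, |h y| ≤ 1) → (∀ y, |k y| ≤ 1) → (∀ y, |l y| ≤ 1) →
      |U₃ ((t • (((EuclideanSpace.equiv ι ℝ).symm : (ι → ℝ) →L[ℝ] EuclideanSpace ℝ ι).comp
          (ContinuousLinearMap.pi fun x : ι => (EuclideanSpace.proj (β x) : EuclideanSpace ℝ ι' →L[ℝ] ℝ)))) v)
        ((t • (((EuclideanSpace.equiv ι ℝ).symm : (ι → ℝ) →L[ℝ] EuclideanSpace ℝ ι).comp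
          (ContinuousLinearMap.pi fun x : ι => (EuclideanSpace.proj (β x) : EuclideanSpace ℝ ι' →L[ℝ] ℝ)))) h)
        ((t • (((EuclideanSpace.equiv ι ℝ).symm : (ι → ℝ) →L[ℝ] EuclideanSpace ℝ ι).comp
          (ContinuousLinearMap.pi fun x : ι => (EuclideanSpace.proj (β x) : EuclideanSpace ℝ ι' →L[ℝ] ℝ)))) k)
        ((t • (((EuclideanSpace.equiv ι ℝ).symm : (ι → ℝ) →L[ℝ] EuclideanSpace ℝ ι).comp
          (ContinuousLinearMap.pi fun x : ι => (EuclideanSpace.proj (β x) : EuclideanSpace ℝ ι' →L[ℝ] ℝ)))) l)| ≤ |t| ^ 3 * K₃ := by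
  intro v h k l hv hh hk hl
  rw [rescaled_eq_smul_inj β t h, rescaled_eq_smul_inj β t k, rescaled_eq_smul_inj β t l, map_smul, map_smul, map_smul, smul_eq_mul]
  rw [show ∀ (f : EuclideanSpace ℝ ι →L[ℝ] ℝ) (z : EuclideanSpace ℝ ι), (t • f) z = t * f z from fun f z => rfl,
    show ∀ (f : EuclideanSpace ℝ ι →L[ℝ] EuclideanSpace ℝ ι →L[ℝ] ℝ) (z w : EuclideanSpace ℝ ι), (t • f) z w = t * f z w from fun f z w => rfl,
    abs_mul, abs_mul, abs_mul, ← mul_assoc, ← mul_assoc, show |t| * |t| * |t| = |t| ^ 3 by ring]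
  exact mul_le_mul_of_nonneg_left
    (hU₃ _ _ _ _ (fun x => (abs_rescaled_apply_le β t hv x).trans hR) (fun x => abs_inj_apply_le β hh x) (fun x => abs_inj_apply_le β hk x)
      fun x => abs_inj_apply_le β hl x) (by positivity)

/-! ## §3. Derivation by extraction: the quadratic letter from the cubic one and the radius -/

/-- Along the segment `s ↦ s • φ`, the evaluated Hessian `s ↦ U″(s•φ)[h,k]` has derivative `U‴(s•φ)[φ,h,k]`. [folklore] -/
theorem hasDerivAt_hess_along_segment (hU''d : ∀ ψ : EuclideanSpace ℝ ι, HasFDerivAt U'' (U₃ ψ) ψ) (φ h k : EuclideanSpace ℝ ι) (s : ℝ) :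
    HasDerivAt (fun s : ℝ => U'' (s • φ) h k) (U₃ (s • φ) φ h k) s := by
  have hγ : HasDerivAt (fun s : ℝ => s • φ) φ s := by
    simpa using (hasDerivAt_id s).smul_const φ
  have h1 := (hU''d (s • φ)).comp_hasDerivAt s hγ
  have h2 := ((ContinuousLinearMap.apply ℝ ℝ k).comp (ContinuousLinearMap.apply ℝ (EuclideanSpace ℝ ι →L[ℝ] ℝ) h)).hasFDerivAt.comp_hasDerivAt s h1
  simpa [Function.comp_def] using h2

/-- **THE QUADRATIC LETTER IS DERIVED ONCE ITS VALUE AT `0` IS EXTRACTED**: if `|U‴(ψ)[a,b,c]| ≤ K₃` for `|ψ|_∞ ≤ R` and unit sup-ball test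
vectors, then for `|φ|_∞ ≤ R` (`R > 0`) and unit `h, k`: `|U″(φ)[h,k] − U″(0)[h,k]| ≤ R·K₃` (mean value along `s ↦ s•φ`, with `a = φ∕R`). [folklore] -/
theorem letter2_derived (hU''d : ∀ ψ : EuclideanSpace ℝ ι, HasFDerivAt U'' (U₃ ψ) ψ) (hRpos : 0 < R)
    (hU₃ : ∀ ψ a b c : EuclideanSpace ℝ ι, (∀ x, |ψ x| ≤ R) → (∀ x, |a x| ≤ 1) → (∀ x, |b x| ≤ 1) → (∀ x, |c x| ≤ 1) → |U₃ ψ a b c| ≤ K₃) :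
    ∀ φ h k : EuclideanSpace ℝ ι, (∀ x, |φ x| ≤ R) → (∀ x, |h x| ≤ 1) → (∀ x, |k x| ≤ 1) → |U'' φ h k - U'' 0 h k| ≤ R * K₃ := by
  intro φ h k hφ hh hk
  have hderiv : ∀ s ∈ Icc (0 : ℝ) 1, HasDerivWithinAt (fun s : ℝ => U'' (s • φ) h k) (U₃ (s • φ) φ h k) (Icc (0 : ℝ) 1) s :=
    fun s _ => (hasDerivAt_hess_along_segment hU''d φ h k s).hasDerivWithinAt
  have hbound : ∀ s ∈ Ico (0 : ℝ) 1, ‖U₃ (s • φ) φ h k‖ ≤ R * K₃ := by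
    intro s hs
    have hsφ : ∀ x, |(s • φ) x| ≤ R := by
      intro x
      rw [PiLp.smul_apply, smul_eq_mul, abs_mul, abs_of_nonneg hs.1]
      calc s * |φ x| ≤ 1 * |φ x| := mul_le_mul_of_nonneg_right hs.2.le (abs_nonneg _)
        _ = |φ x| := one_mul _
        _ ≤ R := hφ x
    have ha : ∀ x, |(R⁻¹ • φ) x| ≤ 1 := by
      intro x
      rw [PiLp.smul_apply, smul_eq_mul, abs_mul, abs_of_nonneg (inv_nonneg.2 hRpos.le)]
      rw [inv_mul_le_iff₀ hRpos, mul_one]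
      exact hφ x
    have h1 : U₃ (s • φ) φ h k = R * U₃ (s • φ) (R⁻¹ • φ) h k := by
      rw [map_smul,
        show ∀ (X : EuclideanSpace ℝ ι →L[ℝ] EuclideanSpace ℝ ι →L[ℝ] ℝ) (c : ℝ), (c • X) h k = c * X h k from fun X c => rfl]
      field_simp
    rw [h1, Real.norm_eq_abs, abs_mul, abs_of_pos hRpos]
    exact mul_le_mul_of_nonneg_left (hU₃ _ _ _ _ hsφ ha hh hk) hRpos.le
  have hmv := norm_image_sub_le_of_norm_deriv_le_segment_01' hderiv hbound
  simpa only [one_smul, zero_smul, Real.norm_eq_abs] using hmv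

/-! ## §4. Extensivity and the canonical table -/

/-- **PER-SITE LETTERS MOVE BY `n·|t|^k`**: an extensive letter `K = N·κ` of a region of `N = n·N′` fine sites (`N′` coarse sites, `n` per
block), transported by `|t|^k`, has per-coarse-site value `|t|^k·K ∕ N′ = (n·|t|^k)·κ`. [folklore] -/
theorem per_site_letter {K κ N N' n : ℝ} (k : ℕ) (hK : K = N * κ) (hN : N = n * N') (hN' : N' ≠ 0) :
    |t| ^ k * K / N' = (n * |t| ^ k) * κ := by
  rw [hK, hN]; field_simp

/-- **THE CANONICAL POWER**: `n·t^k = L^d·(L^{−(d−2)∕2})^k = L^{d − k(d−2)∕2}` (`L > 0`; real powers). [folklore] -/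
theorem canonical_power {L : ℝ} (hL : 0 < L) (d k : ℕ) :
    L ^ (d : ℝ) * (L ^ (-(((d : ℝ) - 2) / 2))) ^ k = L ^ ((d : ℝ) - k * (((d : ℝ) - 2) / 2)) := by
  rw [← Real.rpow_natCast (L ^ (-(((d : ℝ) - 2) / 2))) k, ← Real.rpow_mul hL.le, ← Real.rpow_add hL]
  congr 1
  ring

/-- **THE TABLE AT `d = 4`** (`t = L⁻¹`, `n = L⁴`, `L > 0`): the per-site factor `L⁴·(L⁻¹)^k` for `k = 0,…,6` is `L⁴, L³, L², L, 1, L⁻¹, L⁻²`. [folklore] -/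
theorem canonical_table_dim4 {L : ℝ} (hL : 0 < L) :
    L ^ 4 * (L⁻¹) ^ 0 = L ^ 4 ∧ L ^ 4 * (L⁻¹) ^ 1 = L ^ 3 ∧ L ^ 4 * (L⁻¹) ^ 2 = L ^ 2 ∧ L ^ 4 * (L⁻¹) ^ 3 = L ∧ L ^ 4 * (L⁻¹) ^ 4 = 1 ∧
      L ^ 4 * (L⁻¹) ^ 5 = L⁻¹ ∧ L ^ 4 * (L⁻¹) ^ 6 = (L ^ 2)⁻¹ := by
  have hL0 : L ≠ 0 := hL.ne'
  refine ⟨?_, ?_, ?_, ?_, ?_, ?_, ?_⟩ <;> field_simp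

/-- **RELEVANT ∕ MARGINAL ∕ IRRELEVANT AT `d = 4`** (`L > 1`): the factors of orders `k ≤ 3` exceed `1` (relevant — to be EXTRACTED, not
carried), order `4` is exactly `1` (marginal — the quartic coupling, the β-function's object), orders `5, 6` are `< 1` (irrelevant —
the remainder contracts). [folklore] -/
theorem relevant_marginal_irrelevant_dim4 {L : ℝ} (hL : 1 < L) :
    (1 < L ^ 4 * (L⁻¹) ^ 0 ∧ 1 < L ^ 4 * (L⁻¹) ^ 1 ∧ 1 < L ^ 4 * (L⁻¹) ^ 2 ∧ 1 < L ^ 4 * (L⁻¹) ^ 3) ∧ L ^ 4 * (L⁻¹) ^ 4 = 1 ∧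
      (L ^ 4 * (L⁻¹) ^ 5 < 1 ∧ L ^ 4 * (L⁻¹) ^ 6 < 1) := by
  have hL0 : 0 < L := lt_trans zero_lt_one hL
  obtain ⟨h0, h1, h2, h3, h4, h5, h6⟩ := canonical_table_dim4 hL0
  rw [h0, h1, h2, h3, h4, h5, h6]
  refine ⟨⟨?_, ?_, ?_, ?_⟩, rfl, ?_, ?_⟩
  · exact one_lt_pow₀ hL (by norm_num)
  · exact one_lt_pow₀ hL (by norm_num)
  · exact one_lt_pow₀ hL (by norm_num)
  · exact hL
  · exact inv_lt_one_of_one_lt₀ hL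
  · exact inv_lt_one_of_one_lt₀ (by nlinarith)

/-! ## §5. Toy -/

/-- Toy (kernel): `L = 2`, order `5`: the per-site factor is `2⁴·(2⁻¹)⁵ = 1∕2 < 1`. -/
example : (2 : ℝ) ^ 4 * ((2 : ℝ)⁻¹) ^ 5 < 1 := by norm_num

end Summit.QuantumFields.BalabanUV.T4Continuum.NE7b.SupPowerCountingLetters

end
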